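import Summits.MatrixMultiplication.OmegaCensus.DicyclicN3Stable
import HarnessLib

/-!
# Class N3 for odd-part quotients, core: the four trichotomies over any `2`-group image

ω-census `pub-omega`, family (b3), seat pub-omega-group gen 13.  Framing: lottery ticket; floor = certified bounds/negative
ranges.  VALUE: kernel lemmas for the TPP capacity of dihedral-like groups; NOT progress on ω.

Gen 11's `PeriodicBoxWindow.pair_diff_trichotomy_of_periodic_box` and `DicyclicN3Stable.n3_pair_trichotomy_core` are stated for
the quotient map `π : A → A/⟨c₀⟩` (kernel `{0, c₀}`) onto a `2`-GROUP.  Their proofs use only `π c₀ = 0`: here they are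
re-derived for an arbitrary homomorphism `π : A →+ B` into a `2`-group `B` with `π c₀ = 0` (`c₀ ≠ 0`, `2c₀ = 0`) — to be
applied with `B = 𝔽₂³`, `π = (ψ₁, ψ₂, ψ₃)` when `A/⟨c₀⟩` has an odd part.

* `pair_diff_trichotomy_of_periodic_box'`: injective `c₀`-periodic box `{s,s+d} + {t,t+e} + W`, `|W|` odd ⇒
  `π d = 0 ∨ π e = 0 ∨ π d = π e` (window parity + the `𝔽₂[B]` window lemma).
* `n3_trichotomies'`: for a TPP triple of dicyclic type with `|S₀| = |S₁| = |T₀| = |T₁| = 2`, `|U₁|` odd and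
  `8|U₁| + 4|U₀| = |A|` (class N3, normalised), the four pairs of differences `(dᵢ, eⱼ)` of the parts of `S` and `T` all
  satisfy the trichotomy (via the `τ0`-translates of `S` and `T`, as in gen 11's `n3_stable_member_aux`).
-/

namespace Summit.MatrixMultiplication.OmegaCensus

open Literature.Combinatorics.Additive Finset

section Window

variable {A : Type} [AddCommGroup A] [Fintype A] [DecidableEq A] {B : Type} [AddCommGroup B] [Fintype B]
  [DecidableEq B]

omit [Fintype A] in
/-- **Trichotomy for the pair of differences, any `2`-group target.**  `π : A →+ B`, `2^m · B = 0`, `π c₀ = 0`, `c₀ ≠ 0`,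
`2c₀ = 0`; an injective `c₀`-periodic box `{s, s+d} + {t, t+e} + W` with `d, e ≠ 0` and `|W|` odd.  Then `π d = 0`, or
`π e = 0`, or `π d = π e` (with `2 π d = 0`). [folklore] -/
theorem pair_diff_trichotomy_of_periodic_box' (π : A →+ B) {c₀ : A} (hπc : π c₀ = 0) (hc₀ : c₀ ≠ 0)
    (h2c : c₀ + c₀ = 0) {m : ℕ} (hB : ∀ b : B, (2 ^ m) • b = 0)
    {s d t e : A} {W : Finset A} (hd : d ≠ 0) (he : e ≠ 0) (hW : Odd W.card)
    (hinj : Set.InjOn (fun p : A × A × A => p.1 + p.2.1 + p.2.2) ↑(({s, s + d} : Finset A) ×ˢ ({t, t + e} : Finset A) ×ˢ W))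
    (hper : ((({s, s + d} : Finset A) ×ˢ ({t, t + e} : Finset A) ×ˢ W).image
      fun p : A × A × A => p.1 + p.2.1 + p.2.2).image (· + c₀) =
      (({s, s + d} : Finset A) ×ˢ ({t, t + e} : Finset A) ×ˢ W).image fun p : A × A × A => p.1 + p.2.1 + p.2.2) :
    π d = 0 ∨ π e = 0 ∨ (π d = π e ∧ π d + π d = 0) := by
  have hsd : s ≠ s + d := fun h => hd (left_eq_add.1 h)
  have hte : t ≠ t + e := fun h => he (left_eq_add.1 h)
  -- window parity of the fibre counts of `W`
  set f : B → ZMod 2 := fun z => ((W.filter fun w => π w = z).card : ZMod 2) with hf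
  have hw : ∀ z : B, f z + f (z + -π d) + f (z + -π e) + f (z + -π d + -π e) = 0 := by
    intro z
    have hev := even_card_fibre_of_periodic π hπc hc₀ h2c hper (z + π s + π t)
    rw [card_fibre_box_eq_sum π hinj, sum_pair hsd, sum_pair hte, sum_pair hte] at hev
    simp only [map_add] at hev
    have e1 : z + π s + π t - π s - π t = z := by abel
    have e2 : z + π s + π t - π s - (π t + π e) = z + -π e := by abel
    have e3 : z + π s + π t - (π s + π d) - π t = z + -π d := by abel
    have e4 : z + π s + π t - (π s + π d) - (π t + π e) = z + -π d + -π e := by abel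
    rw [e1, e2, e3, e4] at hev
    have hcast : (((W.filter fun w => π w = z).card + (W.filter fun w => π w = z + -π e).card +
        ((W.filter fun w => π w = z + -π d).card + (W.filter fun w => π w = z + -π d + -π e).card) : ℕ) : ZMod 2) = 0 :=
      (ZMod.natCast_eq_zero_iff _ 2).2 hev
    push_cast at hcast
    simp only [hf]
    linear_combination hcast
  -- the parity function has odd weight
  have hsum : ∑ z : B, f z = 1 := by
    have hnat : ∑ z : B, (W.filter fun w => π w = z).card = W.card :=
      (card_eq_sum_card_fiberwise (f := π) (s := W) (t := univ) fun w _ => mem_univ _).symm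
    have : ((∑ z : B, (W.filter fun w => π w = z).card : ℕ) : ZMod 2) = (W.card : ZMod 2) := by rw [hnat]
    push_cast at this
    rw [hf]
    rw [this]
    obtain ⟨k, hk⟩ := hW
    rw [hk]; push_cast
    rw [show (2 : ZMod 2) = 0 from rfl, zero_mul, zero_add]
  rcases window_lemma hB f hsum (-π d) (-π e) hw with h | h | ⟨h1, h2⟩
  · exact Or.inl (neg_eq_zero.1 h)
  · exact Or.inr (Or.inl (neg_eq_zero.1 h))
  · refine Or.inr (Or.inr ⟨neg_injective h1, ?_⟩)
    have := congrArg Neg.neg h2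
    rwa [neg_add, neg_neg, neg_zero] at this

end Window

section N3

variable {A : Type} [AddCommGroup A] [DecidableEq A] [Fintype A] {G : Type} [Group G] [DecidableEq G]
  {ρ τ : A → G} {c₀ : A} {B : Type} [AddCommGroup B] [DecidableEq B] [Fintype B]

/-- **Core (vertex `111`), any `2`-group target.**  As `n3_pair_trichotomy_core` with `π : A →+ B` only required to kill
`c₀`. [folklore] -/
theorem n3_pair_trichotomy_core'
    (hρρ : ∀ a b, ρ a * ρ b = ρ (a + b)) (hρτ : ∀ a b, ρ a * τ b = τ (b - a))
    (hτρ : ∀ a b, τ a * ρ b = τ (a + b)) (hττ : ∀ a b, τ a * τ b = ρ (c₀ + b - a)) (hc₀ : c₀ ≠ 0)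
    (hρ : Function.Injective ρ) (hτ : Function.Injective τ) (hne : ∀ a b, ρ a ≠ τ b)
    (π : A →+ B) (hπc : π c₀ = 0) {m : ℕ} (hB : ∀ b : B, (2 ^ m) • b = 0)
    {S T U : Finset G} (h : TripleProductProperty S T U)
    (hs₀ : (univ.filter fun a : A => ρ a ∈ S).card = 2) (hs₁ : (univ.filter fun a : A => τ a ∈ S).card = 2)
    (ht₀ : (univ.filter fun a : A => ρ a ∈ T).card = 2)
    (hodd : Odd (univ.filter fun a : A => τ a ∈ U).card)
    (hex : 2 * (univ.filter fun a : A => τ a ∈ T).card * (univ.filter fun a : A => τ a ∈ U).card +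
      4 * (univ.filter fun a : A => τ a ∈ U).card +
      2 * (univ.filter fun a : A => τ a ∈ T).card * (univ.filter fun a : A => ρ a ∈ U).card = Fintype.card A)
    {s s' t t' : A} (hs : s ∈ (univ.filter fun a : A => τ a ∈ S)) (hs' : s' ∈ (univ.filter fun a : A => τ a ∈ S))
    (hss : s ≠ s') (ht : t ∈ (univ.filter fun a : A => ρ a ∈ T)) (ht' : t' ∈ (univ.filter fun a : A => ρ a ∈ T))
    (htt : t ≠ t') :
    π (s' - s) = 0 ∨ π (t' - t) = 0 ∨ (π (s' - s) = π (t' - t) ∧ π (s' - s) + π (s' - s) = 0) := by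
  set S₀ : Finset A := univ.filter fun a => ρ a ∈ S with hS₀
  set S₁ : Finset A := univ.filter fun a => τ a ∈ S with hS₁
  set T₀ : Finset A := univ.filter fun a => ρ a ∈ T with hT₀
  set T₁ : Finset A := univ.filter fun a => τ a ∈ T with hT₁
  set U₀ : Finset A := univ.filter fun a => ρ a ∈ U with hU₀
  set U₁ : Finset A := univ.filter fun a => τ a ∈ U with hU₁
  have h2c := two_c0_eq_zero hρτ hτρ hττ hτ
  have mS₀ : ∀ a ∈ S₀, cond false (τ a) (ρ a) ∈ S := fun a ha => by simpa [hS₀] using ha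
  have mS₁ : ∀ a ∈ S₁, cond true (τ a) (ρ a) ∈ S := fun a ha => by simpa [hS₁] using ha
  have mT₀ : ∀ a ∈ T₀, cond false (τ a) (ρ a) ∈ T := fun a ha => by simpa [hT₀] using ha
  have mT₁ : ∀ a ∈ T₁, cond true (τ a) (ρ a) ∈ T := fun a ha => by simpa [hT₁] using ha
  have mU₀ : ∀ a ∈ U₀, cond false (τ a) (ρ a) ∈ U := fun a ha => by simpa [hU₀] using ha
  have mU₁ : ∀ a ∈ U₁, cond true (τ a) (ρ a) ∈ U := fun a ha => by simpa [hU₁] using ha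
  have cs := card_sumset' hρρ hττ hρ hτ h
  have inj := sum_injOn' hρρ hττ hρ hτ h
  set B011 := (S₀ ×ˢ T₁ ×ˢ U₁).image fun p : A × A × A => p.1 + p.2.1 + p.2.2 with hB011
  set B101 := (S₁ ×ˢ T₀ ×ˢ U₁).image fun p : A × A × A => p.1 + p.2.1 + p.2.2 with hB101
  set B110 := (S₁ ×ˢ T₁ ×ˢ U₀).image fun p : A × A × A => p.1 + p.2.1 + p.2.2 with hB110
  have d₁ : Disjoint B101 B011 := (disjoint_sumset₁' hρρ hρτ hτρ hττ hne h) true mS₁ mT₀ mU₁ mS₀ mT₁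
  have d₂ : Disjoint B110 B101 := (disjoint_sumset₂' hρρ hρτ hτρ hττ hne h) true mS₁ mT₁ mU₀ mS₁ mT₀ mU₁
  have d₃ : Disjoint B011 B110 := (disjoint_sumset₃' hρρ hρτ hτρ hττ hne h) true mS₀ mT₁ mU₁ mS₁ mU₀
  have sh₁ : Disjoint B101 (B011.image (· + c₀)) :=
    (disjoint_sumset₁_shift' hρρ hρτ hττ hne h) true mS₁ mT₀ mU₁ mS₀ mT₁
  have sh₂ : Disjoint (B101.image (· + c₀)) B110 :=
    (disjoint_sumset₂_shift' hρρ hρτ hττ hne h) true mS₁ mT₀ mU₁ mS₁ mT₁ mU₀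
  have c011 : B011.card = 2 * T₁.card * U₁.card := by rw [hB011, cs false true true mS₀ mT₁ mU₁, hs₀]
  have c101 : B101.card = 2 * 2 * U₁.card := by rw [hB101, cs true false true mS₁ mT₀ mU₁, hs₁, ht₀]
  have c110 : B110.card = 2 * T₁.card * U₀.card := by rw [hB110, cs true true false mS₁ mT₁ mU₀, hs₁]
  have hper101 : B101.image (· + c₀) = B101 :=
    periodic_of_exact_vertex d₁ d₂.symm d₃ (by rw [c011, c101, c110, ← hex]; ring)
      (disjoint_image_add_comm h2c sh₁) sh₂
  have hS₁eq : S₁ = {s, s + (s' - s)} := by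
    rw [add_sub_cancel]
    exact (eq_of_subset_of_card_le (by
      intro x hx; rcases mem_insert.1 hx with rfl | hx
      · exact hs
      · rw [mem_singleton.1 hx]; exact hs') (by rw [hs₁, card_pair hss])).symm
  have hT₀eq : T₀ = {t, t + (t' - t)} := by
    rw [add_sub_cancel]
    exact (eq_of_subset_of_card_le (by
      intro x hx; rcases mem_insert.1 hx with rfl | hx
      · exact ht
      · rw [mem_singleton.1 hx]; exact ht') (by rw [ht₀, card_pair htt])).symm
  have hinj : Set.InjOn (fun p : A × A × A => p.1 + p.2.1 + p.2.2)
      ↑(({s, s + (s' - s)} : Finset A) ×ˢ ({t, t + (t' - t)} : Finset A) ×ˢ U₁) := by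
    rw [← hS₁eq, ← hT₀eq]; exact inj true false true mS₁ mT₀ mU₁
  have hper : ((({s, s + (s' - s)} : Finset A) ×ˢ ({t, t + (t' - t)} : Finset A) ×ˢ U₁).image
      fun p : A × A × A => p.1 + p.2.1 + p.2.2).image (· + c₀) =
      (({s, s + (s' - s)} : Finset A) ×ˢ ({t, t + (t' - t)} : Finset A) ×ˢ U₁).image
      fun p : A × A × A => p.1 + p.2.1 + p.2.2 := by
    rw [← hS₁eq, ← hT₀eq]; exact hper101
  exact pair_diff_trichotomy_of_periodic_box' π hπc hc₀ h2c hB (sub_ne_zero.2 hss.symm) (sub_ne_zero.2 htt.symm) hodd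
    hinj hper

/-- **The four trichotomies of an N3 triple, any `2`-group target.**  Dicyclic type, `π : A →+ B` into a `2`-group with
`π c₀ = 0`; a TPP triple with parts `S₀ = {s₀, s₀'}`, `S₁ = {s₁, s₁'}`, `T₀ = {t₀, t₀'}`, `T₁ = {t₁, t₁'}`, `|U₁|` odd and
`8|U₁| + 4|U₀| = |A|`.  Then each pair `(dᵢ, eⱼ)` of differences `d₀ = s₀'−s₀`, `d₁ = s₁'−s₁`, `e₀ = t₀'−t₀`, `e₁ = t₁'−t₁`
satisfies `π dᵢ = 0 ∨ π eⱼ = 0 ∨ π dᵢ = π eⱼ`. [folklore] -/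
theorem n3_trichotomies'
    (hρρ : ∀ a b, ρ a * ρ b = ρ (a + b)) (hρτ : ∀ a b, ρ a * τ b = τ (b - a))
    (hτρ : ∀ a b, τ a * ρ b = τ (a + b)) (hττ : ∀ a b, τ a * τ b = ρ (c₀ + b - a)) (hc₀ : c₀ ≠ 0)
    (hρ : Function.Injective ρ) (hτ : Function.Injective τ) (hne : ∀ a b, ρ a ≠ τ b)
    (π : A →+ B) (hπc : π c₀ = 0) {m : ℕ} (hB : ∀ b : B, (2 ^ m) • b = 0)
    {S T U : Finset G} (h : TripleProductProperty S T U)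
    {s₀ s₀' s₁ s₁' t₀ t₀' t₁ t₁' : A} (hss₀ : s₀ ≠ s₀') (hss₁ : s₁ ≠ s₁') (htt₀ : t₀ ≠ t₀') (htt₁ : t₁ ≠ t₁')
    (hS₀eq : (univ.filter fun a : A => ρ a ∈ S) = {s₀, s₀'}) (hS₁eq : (univ.filter fun a : A => τ a ∈ S) = {s₁, s₁'})
    (hT₀eq : (univ.filter fun a : A => ρ a ∈ T) = {t₀, t₀'}) (hT₁eq : (univ.filter fun a : A => τ a ∈ T) = {t₁, t₁'})
    (hodd : Odd (univ.filter fun a : A => τ a ∈ U).card)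
    (hex : 8 * (univ.filter fun a : A => τ a ∈ U).card + 4 * (univ.filter fun a : A => ρ a ∈ U).card = Fintype.card A) :
    (π (s₀' - s₀) = 0 ∨ π (t₀' - t₀) = 0 ∨ π (s₀' - s₀) = π (t₀' - t₀)) ∧
    (π (s₀' - s₀) = 0 ∨ π (t₁' - t₁) = 0 ∨ π (s₀' - s₀) = π (t₁' - t₁)) ∧
    (π (s₁' - s₁) = 0 ∨ π (t₀' - t₀) = 0 ∨ π (s₁' - s₁) = π (t₀' - t₀)) ∧
    (π (s₁' - s₁) = 0 ∨ π (t₁' - t₁) = 0 ∨ π (s₁' - s₁) = π (t₁' - t₁)) := by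
  set S₀ : Finset A := univ.filter fun a => ρ a ∈ S with hS₀
  set S₁ : Finset A := univ.filter fun a => τ a ∈ S with hS₁
  set T₀ : Finset A := univ.filter fun a => ρ a ∈ T with hT₀
  set T₁ : Finset A := univ.filter fun a => τ a ∈ T with hT₁
  set U₀ : Finset A := univ.filter fun a => ρ a ∈ U with hU₀
  set U₁ : Finset A := univ.filter fun a => τ a ∈ U with hU₁
  have hs₀ : S₀.card = 2 := by rw [hS₀eq, card_pair hss₀]
  have hs₁ : S₁.card = 2 := by rw [hS₁eq, card_pair hss₁]
  have ht₀ : T₀.card = 2 := by rw [hT₀eq, card_pair htt₀]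
  have ht₁ : T₁.card = 2 := by rw [hT₁eq, card_pair htt₁]
  have er : (Equiv.mulRight (1 : G)).toEmbedding = Function.Embedding.refl G := by ext x; simp
  have ms₀ : s₀ ∈ S₀ := by rw [hS₀eq]; exact mem_insert_self _ _
  have ms₀' : s₀' ∈ S₀ := by rw [hS₀eq]; exact mem_insert_of_mem (mem_singleton_self _)
  have ms₁ : s₁ ∈ S₁ := by rw [hS₁eq]; exact mem_insert_self _ _
  have ms₁' : s₁' ∈ S₁ := by rw [hS₁eq]; exact mem_insert_of_mem (mem_singleton_self _)
  have mt₀ : t₀ ∈ T₀ := by rw [hT₀eq]; exact mem_insert_self _ _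
  have mt₀' : t₀' ∈ T₀ := by rw [hT₀eq]; exact mem_insert_of_mem (mem_singleton_self _)
  have mt₁ : t₁ ∈ T₁ := by rw [hT₁eq]; exact mem_insert_self _ _
  have mt₁' : t₁' ∈ T₁ := by rw [hT₁eq]; exact mem_insert_of_mem (mem_singleton_self _)
  -- the translates `S·τ0`, `T·τ0` and their parts
  set S' := S.map (Equiv.mulRight (τ 0)).toEmbedding with hS'
  set T' := T.map (Equiv.mulRight (τ 0)).toEmbedding with hT'
  have hS'₀ : (univ.filter fun a : A => ρ a ∈ S') = S₁.image fun b => -c₀ - b := rho_part_mulRight_tau hρρ hρτ hττ S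
  have hS'₁ : (univ.filter fun a : A => τ a ∈ S') = S₀.image fun b => -b := tau_part_mulRight_tau hρρ hττ S
  have hT'₀ : (univ.filter fun a : A => ρ a ∈ T') = T₁.image fun b => -c₀ - b := rho_part_mulRight_tau hρρ hρτ hττ T
  have hT'₁ : (univ.filter fun a : A => τ a ∈ T') = T₀.image fun b => -b := tau_part_mulRight_tau hρρ hττ T
  have cS'₀ : (univ.filter fun a : A => ρ a ∈ S').card = 2 := by
    rw [hS'₀, card_image_of_injective _ sub_right_injective, hs₁]
  have cS'₁ : (univ.filter fun a : A => τ a ∈ S').card = 2 := by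
    rw [hS'₁, card_image_of_injective _ neg_injective, hs₀]
  have cT'₀ : (univ.filter fun a : A => ρ a ∈ T').card = 2 := by
    rw [hT'₀, card_image_of_injective _ sub_right_injective, ht₁]
  have cT'₁ : (univ.filter fun a : A => τ a ∈ T').card = 2 := by
    rw [hT'₁, card_image_of_injective _ neg_injective, ht₀]
  have hS'T : TripleProductProperty S' T U := by
    have := h.map_mulRight (τ 0) 1 1; simpa only [er, Finset.map_refl] using this
  have hST' : TripleProductProperty S T' U := by
    have := h.map_mulRight 1 (τ 0) 1; simpa only [er, Finset.map_refl] using this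
  have hS'T' : TripleProductProperty S' T' U := by
    have := h.map_mulRight (τ 0) (τ 0) 1; simpa only [er, Finset.map_refl] using this
  have mS'₁ : ∀ {b}, b ∈ S₀ → -b ∈ (univ.filter fun a : A => τ a ∈ S') := fun hb => by
    rw [hS'₁]; exact mem_image_of_mem _ hb
  have mT'₀ : ∀ {b}, b ∈ T₁ → -c₀ - b ∈ (univ.filter fun a : A => ρ a ∈ T') := fun hb => by
    rw [hT'₀]; exact mem_image_of_mem _ hb
  have hexT : 2 * (univ.filter fun a : A => τ a ∈ T).card * U₁.card + 4 * U₁.card +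
      2 * (univ.filter fun a : A => τ a ∈ T).card * U₀.card = Fintype.card A := by rw [ht₁]; omega
  have hexT' : 2 * (univ.filter fun a : A => τ a ∈ T').card * U₁.card + 4 * U₁.card +
      2 * (univ.filter fun a : A => τ a ∈ T').card * U₀.card = Fintype.card A := by rw [cT'₁]; omega
  -- the four trichotomies
  have h10 := n3_pair_trichotomy_core' hρρ hρτ hτρ hττ hc₀ hρ hτ hne π hπc hB h hs₀ hs₁ ht₀ hodd hexT
    ms₁ ms₁' hss₁ mt₀ mt₀' htt₀
  have h00 := n3_pair_trichotomy_core' hρρ hρτ hτρ hττ hc₀ hρ hτ hne π hπc hB hS'T cS'₀ cS'₁ ht₀ hodd hexT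
    (mS'₁ ms₀') (mS'₁ ms₀) (fun h' => hss₀ (neg_injective h').symm) mt₀ mt₀' htt₀
  have h11 := n3_pair_trichotomy_core' hρρ hρτ hτρ hττ hc₀ hρ hτ hne π hπc hB hST' hs₀ hs₁ cT'₀ hodd hexT'
    ms₁ ms₁' hss₁ (mT'₀ mt₁') (mT'₀ mt₁) (fun h' => htt₁ (sub_right_injective h').symm)
  have h01 := n3_pair_trichotomy_core' hρρ hρτ hτρ hττ hc₀ hρ hτ hne π hπc hB hS'T' cS'₀ cS'₁ cT'₀ hodd hexT'
    (mS'₁ ms₀') (mS'₁ ms₀) (fun h' => hss₀ (neg_injective h').symm) (mT'₀ mt₁') (mT'₀ mt₁)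
    (fun h' => htt₁ (sub_right_injective h').symm)
  have e_d₀ : -s₀ - -s₀' = s₀' - s₀ := by abel
  have e_e₁ : -c₀ - t₁ - (-c₀ - t₁') = t₁' - t₁ := by abel
  rw [e_d₀] at h00 h01
  rw [e_e₁] at h11 h01
  refine ⟨?_, ?_, ?_, ?_⟩
  · rcases h00 with h' | h' | ⟨h', -⟩
    exacts [Or.inl h', Or.inr (Or.inl h'), Or.inr (Or.inr h')]
  · rcases h01 with h' | h' | ⟨h', -⟩
    exacts [Or.inl h', Or.inr (Or.inl h'), Or.inr (Or.inr h')]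
  · rcases h10 with h' | h' | ⟨h', -⟩
    exacts [Or.inl h', Or.inr (Or.inl h'), Or.inr (Or.inr h')]
  · rcases h11 with h' | h' | ⟨h', -⟩
    exacts [Or.inl h', Or.inr (Or.inl h'), Or.inr (Or.inr h')]

end N3

end Summit.MatrixMultiplication.OmegaCensus
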